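import Summits.NavierStokesRegularity.NavierStokesRegularity.Theorems.EfficiencyFloorNearSaturationNearMaximiserAmplitude
import Summits.NavierStokesRegularity.NavierStokesRegularity.Theses.EfficiencyFloor
import HarnessLib

/-!
# Route `EfficiencyFloor`, crux `NearSaturationNearMaximiser` (stmt-NavierStokesRegularity-25482):
# EXACT RESTATEMENT — the item is equivalent to the SHAPE STABILITY of near-maximisers of the Lu–Doering functional
# at pinned amplitude ratio (the cubic law and the saturation level drop out)

By-name file (`--supports stmt-NavierStokesRegularity-25482`; sequel to `…NearSaturationNearMaximiserAmplitude`, p819457, the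
AMPLITUDE half). The route decl `Theses.EfficiencyFloor.NearSaturationNearMaximiser` hypothesises, for an admissible field `v`,
NEAR-SATURATION of the cubic law `(1−δ)(27c⁴/(128ν³))Z³ ≤ 2S − 2ν·Pal` and concludes `ε`-closeness (scale-free `Ḣ¹ ∩ Ḣ²`)
to a normalised maximiser. Here:

* `Amplitude.saturation_of_efficiency_of_window` (§1, real algebra, converse of the amplitude half): efficiency
  `S ≥ (1−δ′)·cZ^{3/4}Pal^{3/4}` together with the ratio window `|Pal^{1/4} − (3c/(4ν))Z^{3/4}| ≤ δ′·(3c/(4ν))Z^{3/4}`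
  (`0 ≤ δ′ ≤ 1`) give back `(1−δ)`-saturation for every `δ ≥ 49δ′`
  (`(b−u)²(3b²+2bu+u²) + 4δ′ub³ ≤ (17δ′² + 32δ′)u⁴`);
* `nearSaturationNearMaximiser_iff_shape` (§2, BY NAME against the route decl): **`NearSaturationNearMaximiser ⟺ SHAPE`**,
  where SHAPE is the route decl with the single saturation hypothesis REPLACED by the two static, scale-free hypotheses
  "efficiency `≥ 1 − δ`" and "quarter-power ratio window of relative width `δ`" — everything else (the sharp-constant
  clause, `∀ ν`, admissibility, `0 < Z(v)`, the normalised-maximiser conclusion) VERBATIM. `→`: §1 with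
  `δ′ = min(δ/49, 1)`; `←`: the amplitude half (`Amplitude.efficiency_ge`, `Amplitude.quarter_window`) with
  `δ = (min(δ′,1)/2)²`.

READING. The open content of stmt-25482 is therefore exactly: near-maximal EFFICIENCY of the scale-invariant functional
`S/(Z^{3/4}Pal^{3/4})` (plus a pinned amplitude ratio, which only fixes WHICH normalised maximiser to compare with) forces
`Ḣ¹ ∩ Ḣ²`-closeness to a maximiser — a concentration-compactness / quantitative-stability statement for the Lu–Doering
variational problem on `ℝ³` (attainment of `c⋆` included), with no viscosity, no cubic law and no dynamics in it.
HONEST FRAMING: an equivalence between two OPEN statements; neither side is asserted; stmt-25482, `LerayFloorGap` (25164),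
`ProductionEfficiencyDecay` (22866) and Navier–Stokes regularity stay OPEN; no summit statement is proved. [folklore]
-/

-- the problem directory repeats the summit name (`NavierStokesRegularity/NavierStokesRegularity`)
set_option linter.dupNamespace false

noncomputable section

namespace Summit.NavierStokesRegularity.NavierStokesRegularity.Theorems

namespace NearSaturationNearMaximiser

open MeasureTheory
open scoped InnerProductSpace
open Literature.Analysis.FluidPDE

/-! ### §1 The converse algebra: efficiency + ratio window ⟹ near-saturation -/

namespace Amplitude

/-- **Efficiency and a pinned ratio give back near-saturation.** For `c, ν > 0`, `Z, Pal ≥ 0`, `0 ≤ δ′ ≤ 1` and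
`49δ′ ≤ δ`: if `(1−δ′)·cZ^{3/4}Pal^{3/4} ≤ S` and `|Pal^{1/4} − (3c/(4ν))Z^{3/4}| ≤ δ′·(3c/(4ν))Z^{3/4}` then
`(1−δ)(27c⁴/(128ν³))Z³ ≤ 2S − 2ν·Pal`. With `b = Pal^{1/4}`, `u = (3c/(4ν))Z^{3/4}`:
`(2ν/3)[(1−δ)u⁴ + 3b⁴ − 4(1−δ′)ub³] = (2ν/3)[(b−u)²(3b²+2bu+u²) + 4δ′ub³ − δu⁴] ≤ (2ν/3)(17δ′² + 32δ′ − δ)u⁴ ≤ 0`.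
[folklore] -/
theorem saturation_of_efficiency_of_window {c ν δ δ' Z P S : ℝ} (hc : 0 < c) (hν : 0 < ν)
    (hδ'0 : 0 ≤ δ') (hδ'1 : δ' ≤ 1) (hδ : 49 * δ' ≤ δ) (hZ : 0 ≤ Z) (hP : 0 ≤ P)
    (heff : (1 - δ') * (c * Z ^ (3 / 4 : ℝ) * P ^ (3 / 4 : ℝ)) ≤ S)
    (hwin : |P ^ (1 / 4 : ℝ) - 3 * c / (4 * ν) * Z ^ (3 / 4 : ℝ)| ≤ δ' * (3 * c / (4 * ν) * Z ^ (3 / 4 : ℝ))) :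
    (1 - δ) * (27 * c ^ 4 / (128 * ν ^ 3)) * Z ^ 3 ≤ 2 * S - 2 * ν * P := by
  set b : ℝ := P ^ (1 / 4 : ℝ) with hb_def
  set a : ℝ := Z ^ (3 / 4 : ℝ) with ha_def
  have hb : 0 ≤ b := Real.rpow_nonneg hP _
  have ha : 0 ≤ a := Real.rpow_nonneg hZ _
  have hP1 : P = b ^ 4 := by
    rw [hb_def, ← Real.rpow_mul_natCast hP]; norm_num
  have hP34 : P ^ (3 / 4 : ℝ) = b ^ 3 := by
    rw [hb_def, ← Real.rpow_mul_natCast hP]; norm_num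
  have hZ3 : Z ^ 3 = a ^ 4 := by
    rw [ha_def, ← Real.rpow_mul_natCast hZ]; norm_num
  rw [hP34] at heff
  set u : ℝ := 3 * c / (4 * ν) * a with hu_def
  have hu : 0 ≤ u := by positivity
  -- the window in linear form
  have hlo : (1 - δ') * u ≤ b := by have := (abs_le.1 hwin).1; linarith
  have hhi : b ≤ (1 + δ') * u := by have := (abs_le.1 hwin).2; linarith
  have hb2 : b ≤ 2 * u := hhi.trans (by nlinarith)
  -- the polynomial estimate `(1−δ)u⁴ + 3b⁴ ≤ 4(1−δ′)ub³`
  have hsq : (b - u) ^ 2 ≤ δ' ^ 2 * u ^ 2 := by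
    have h1 : |b - u| ≤ δ' * u := hwin
    have h2 : 0 ≤ δ' * u := by positivity
    calc (b - u) ^ 2 = |b - u| ^ 2 := (sq_abs _).symm
      _ ≤ (δ' * u) ^ 2 := pow_le_pow_left₀ (abs_nonneg _) h1 2
      _ = δ' ^ 2 * u ^ 2 := by ring
  have h17 : 3 * b ^ 2 + 2 * b * u + u ^ 2 ≤ 17 * u ^ 2 := by nlinarith [hb, hu, hb2]
  have hdef : (b - u) ^ 2 * (3 * b ^ 2 + 2 * b * u + u ^ 2) ≤ δ' ^ 2 * u ^ 2 * (17 * u ^ 2) :=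
    mul_le_mul hsq h17 (by positivity) (by positivity)
  have hb3 : b ^ 3 ≤ (2 * u) ^ 3 := pow_le_pow_left₀ hb hb2 3
  have hcub : 4 * δ' * u * b ^ 3 ≤ 32 * δ' * u ^ 4 := by
    have h0 : 0 ≤ 4 * δ' * u := by positivity
    calc 4 * δ' * u * b ^ 3 ≤ 4 * δ' * u * (2 * u) ^ 3 := mul_le_mul_of_nonneg_left hb3 h0
      _ = 32 * δ' * u ^ 4 := by ring
  have hδ'2 : δ' ^ 2 ≤ δ' := by nlinarith
  have hu4 : 0 ≤ u ^ 4 := by positivity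
  have hmain : (1 - δ) * u ^ 4 + 3 * b ^ 4 ≤ 4 * (1 - δ') * u * b ^ 3 := by
    have hfac : 3 * b ^ 4 - 4 * u * b ^ 3 + u ^ 4 = (b - u) ^ 2 * (3 * b ^ 2 + 2 * b * u + u ^ 2) := by ring
    nlinarith [hdef, hcub, hfac, hδ'2, hu4, mul_le_mul_of_nonneg_right hδ hu4,
      mul_le_mul_of_nonneg_right hδ'2 hu4]
  -- back to `Z, P, S`
  have hid1 : (1 - δ) * (27 * c ^ 4 / (128 * ν ^ 3)) * a ^ 4 = 2 * ν / 3 * ((1 - δ) * u ^ 4) := by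
    rw [hu_def]; field_simp; ring
  have hid2 : 2 * ((1 - δ') * (c * a * b ^ 3)) - 2 * ν * b ^ 4 =
      2 * ν / 3 * (4 * (1 - δ') * u * b ^ 3 - 3 * b ^ 4) := by
    rw [hu_def]; field_simp
  have h23 : 0 ≤ 2 * ν / 3 := by positivity
  calc (1 - δ) * (27 * c ^ 4 / (128 * ν ^ 3)) * Z ^ 3 = 2 * ν / 3 * ((1 - δ) * u ^ 4) := by rw [hZ3, hid1]
    _ ≤ 2 * ν / 3 * (4 * (1 - δ') * u * b ^ 3 - 3 * b ^ 4) :=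
        mul_le_mul_of_nonneg_left (by linarith [hmain]) h23
    _ = 2 * ((1 - δ') * (c * a * b ^ 3)) - 2 * ν * b ^ 4 := hid2.symm
    _ ≤ 2 * S - 2 * ν * P := by rw [← hP1]; linarith [heff]

end Amplitude

/-! ### §2 The exact restatement, by name -/

/-- **`NearSaturationNearMaximiser` (stmt-25482) ⟺ SHAPE STABILITY at pinned amplitude ratio.** The right-hand side is the
route decl with its near-saturation hypothesis `(1−δ)(27c⁴/(128ν³))Z³ ≤ 2S − 2ν·Pal` replaced by the pair
`(1−δ)·cZ^{3/4}Pal^{3/4} ≤ S` (efficiency) and `|Pal^{1/4} − (3c/(4ν))Z^{3/4}| ≤ δ·(3c/(4ν))Z^{3/4}` (ratio window),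
all other clauses verbatim. `→`: `Amplitude.saturation_of_efficiency_of_window`; `←`: `Amplitude.efficiency_ge` and
`Amplitude.quarter_window` (p819457). Equivalence of OPEN statements; neither side is asserted. [folklore] -/
theorem nearSaturationNearMaximiser_iff_shape :
    Summit.NavierStokesRegularity.NavierStokesRegularity.Theses.EfficiencyFloor.NearSaturationNearMaximiser ↔
    (∀ c ε : ℝ, (0 < c ∧ (∀ v : EuclideanSpace ℝ (Fin 3) → EuclideanSpace ℝ (Fin 3), (ContDiff ℝ (⊤ : ℕ∞) v ∧
      Literature.Analysis.FluidPDE.VectorCalculus.IsDivFree v ∧ (∫⁻ x, ‖iteratedFDeriv ℝ 0 v x‖ₑ ^ 2 < ⊤) ∧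
      (∫⁻ x, ‖iteratedFDeriv ℝ 1 v x‖ₑ ^ 2 < ⊤) ∧ (∫⁻ x, ‖iteratedFDeriv ℝ 2 v x‖ₑ ^ 2 < ⊤)) → (∫ x,
      ⟪Literature.Analysis.FluidPDE.curl v x, fderiv ℝ v x (Literature.Analysis.FluidPDE.curl v x)⟫_ℝ) ≤ c *
      (∫ x, ‖Literature.Analysis.FluidPDE.curl v x‖ ^ 2) ^ (3 / 4 : ℝ) * (∫ x,
      Literature.Analysis.FluidPDE.frobeniusNormSq (fderiv ℝ (Literature.Analysis.FluidPDE.curl v) x)) ^ (3 /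
      4 : ℝ)) ∧ ∀ c' : ℝ, (∀ w : EuclideanSpace ℝ (Fin 3) → EuclideanSpace ℝ (Fin 3), (ContDiff ℝ (⊤ : ℕ∞) w ∧
      Literature.Analysis.FluidPDE.VectorCalculus.IsDivFree w ∧ (∫⁻ x, ‖iteratedFDeriv ℝ 0 w x‖ₑ ^ 2 < ⊤) ∧
      (∫⁻ x, ‖iteratedFDeriv ℝ 1 w x‖ₑ ^ 2 < ⊤) ∧ (∫⁻ x, ‖iteratedFDeriv ℝ 2 w x‖ₑ ^ 2 < ⊤)) → (∫ x,
      ⟪Literature.Analysis.FluidPDE.curl w x, fderiv ℝ w x (Literature.Analysis.FluidPDE.curl w x)⟫_ℝ) ≤ c' *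
      (∫ x, ‖Literature.Analysis.FluidPDE.curl w x‖ ^ 2) ^ (3 / 4 : ℝ) * (∫ x,
      Literature.Analysis.FluidPDE.frobeniusNormSq (fderiv ℝ (Literature.Analysis.FluidPDE.curl w) x)) ^ (3 /
      4 : ℝ)) → c ≤ c') → 0 < ε → ∃ δ : ℝ, 0 < δ ∧ ∀ ν : ℝ, 0 < ν → ∀ v : EuclideanSpace ℝ (Fin 3) →
      EuclideanSpace ℝ (Fin 3), (ContDiff ℝ (⊤ : ℕ∞) v ∧ Literature.Analysis.FluidPDE.VectorCalculus.IsDivFree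
      v ∧ (∫⁻ x, ‖iteratedFDeriv ℝ 0 v x‖ₑ ^ 2 < ⊤) ∧ (∫⁻ x, ‖iteratedFDeriv ℝ 1 v x‖ₑ ^ 2 < ⊤) ∧ (∫⁻ x,
      ‖iteratedFDeriv ℝ 2 v x‖ₑ ^ 2 < ⊤)) → 0 < (∫ x, ‖Literature.Analysis.FluidPDE.curl v x‖ ^ 2) → (1 - δ) *
      (c * (∫ x, ‖Literature.Analysis.FluidPDE.curl v x‖ ^ 2) ^ (3 / 4 : ℝ) * (∫ x,
      Literature.Analysis.FluidPDE.frobeniusNormSq (fderiv ℝ (Literature.Analysis.FluidPDE.curl v) x)) ^ (3 /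
      4 : ℝ)) ≤ (∫ x, ⟪Literature.Analysis.FluidPDE.curl v x, fderiv ℝ v x (Literature.Analysis.FluidPDE.curl
      v x)⟫_ℝ) → |(∫ x, Literature.Analysis.FluidPDE.frobeniusNormSq (fderiv ℝ
      (Literature.Analysis.FluidPDE.curl v) x)) ^ (1 / 4 : ℝ) - 3 * c / (4 * ν) * (∫ x,
      ‖Literature.Analysis.FluidPDE.curl v x‖ ^ 2) ^ (3 / 4 : ℝ)| ≤ δ * (3 * c / (4 * ν) * (∫ x,
      ‖Literature.Analysis.FluidPDE.curl v x‖ ^ 2) ^ (3 / 4 : ℝ)) → ∃ m : EuclideanSpace ℝ (Fin 3) →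
      EuclideanSpace ℝ (Fin 3), ((ContDiff ℝ (⊤ : ℕ∞) m ∧
      Literature.Analysis.FluidPDE.VectorCalculus.IsDivFree m ∧ (∫⁻ x, ‖iteratedFDeriv ℝ 0 m x‖ₑ ^ 2 < ⊤) ∧
      (∫⁻ x, ‖iteratedFDeriv ℝ 1 m x‖ₑ ^ 2 < ⊤) ∧ (∫⁻ x, ‖iteratedFDeriv ℝ 2 m x‖ₑ ^ 2 < ⊤)) ∧ 0 < (∫ x,
      ‖Literature.Analysis.FluidPDE.curl m x‖ ^ 2) ∧ (∫ x, ⟪Literature.Analysis.FluidPDE.curl m x, fderiv ℝ m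
      x (Literature.Analysis.FluidPDE.curl m x)⟫_ℝ) = c * (∫ x, ‖Literature.Analysis.FluidPDE.curl m x‖ ^ 2) ^
      (3 / 4 : ℝ) * (∫ x, Literature.Analysis.FluidPDE.frobeniusNormSq (fderiv ℝ
      (Literature.Analysis.FluidPDE.curl m) x)) ^ (3 / 4 : ℝ) ∧ (∫ x,
      Literature.Analysis.FluidPDE.frobeniusNormSq (fderiv ℝ (Literature.Analysis.FluidPDE.curl m) x)) = 81 *
      c ^ 4 / (256 * ν ^ 4) * (∫ x, ‖Literature.Analysis.FluidPDE.curl m x‖ ^ 2) ^ 3) ∧ ((∫ x,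
      ‖Literature.Analysis.FluidPDE.curl (v - m) x‖ ^ 2) ≤ ε ^ 2 * (∫ x, ‖Literature.Analysis.FluidPDE.curl v
      x‖ ^ 2) ∧ (∫ x, Literature.Analysis.FluidPDE.frobeniusNormSq (fderiv ℝ
      (Literature.Analysis.FluidPDE.curl (v - m)) x)) ≤ ε ^ 2 * (∫ x,
      Literature.Analysis.FluidPDE.frobeniusNormSq (fderiv ℝ (Literature.Analysis.FluidPDE.curl v) x)))) := by
  constructor
  · -- the item ⟹ shape stability
    intro h c ε hsharp hε
    obtain ⟨δ, hδ, hmain⟩ := h c ε hsharp hε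
    have hc : 0 < c := hsharp.1
    refine ⟨min (δ / 49) 1, lt_min (by positivity) one_pos, fun ν hν v hv hZ heff hwin => ?_⟩
    have hP : 0 ≤ ∫ x, frobeniusNormSq (fderiv ℝ (curl v) x) :=
      integral_nonneg fun x => frobeniusNormSq_nonneg _
    refine hmain ν hν v hv hZ ?_
    exact Amplitude.saturation_of_efficiency_of_window hc hν (le_min (by positivity) zero_le_one)
      (min_le_right _ _) (by linarith [min_le_left (δ / 49) 1]) hZ.le hP heff hwin
  · -- shape stability ⟹ the item
    intro h c ε hsharp hε
    obtain ⟨δ', hδ', hmain⟩ := h c ε hsharp hε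
    have hc : 0 < c := hsharp.1
    set m₁ : ℝ := min δ' 1 with hm₁
    have hm₁pos : 0 < m₁ := lt_min hδ' one_pos
    have hm₁le : m₁ ≤ δ' := min_le_left _ _
    have hm₁one : m₁ ≤ 1 := min_le_right _ _
    refine ⟨(m₁ / 2) ^ 2, by positivity, fun ν hν v hv hZ hsat => ?_⟩
    have hP : 0 ≤ ∫ x, frobeniusNormSq (fderiv ℝ (curl v) x) :=
      integral_nonneg fun x => frobeniusNormSq_nonneg _
    have hS := hsharp.2.1 v hv
    have hδle : (m₁ / 2) ^ 2 ≤ δ' := by nlinarith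
    have hδone : (m₁ / 2) ^ 2 ≤ 1 := by nlinarith
    have hsqrt : Real.sqrt ((m₁ / 2) ^ 2) = m₁ / 2 := Real.sqrt_sq (by positivity)
    -- efficiency
    have heff := Amplitude.efficiency_ge (c := c) hν (by positivity) hδone hZ.le hP hsat
    have hE : 0 ≤ c * (∫ x, ‖curl v x‖ ^ 2) ^ (3 / 4 : ℝ) *
        (∫ x, frobeniusNormSq (fderiv ℝ (curl v) x)) ^ (3 / 4 : ℝ) := by positivity
    have heff' : (1 - δ') * (c * (∫ x, ‖curl v x‖ ^ 2) ^ (3 / 4 : ℝ) *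
        (∫ x, frobeniusNormSq (fderiv ℝ (curl v) x)) ^ (3 / 4 : ℝ)) ≤
        ∫ x, ⟪curl v x, fderiv ℝ v x (curl v x)⟫_ℝ :=
      (mul_le_mul_of_nonneg_right (by linarith) hE).trans heff
    -- window
    have hwin := Amplitude.quarter_window hc hν hZ hP hS hsat
    rw [hsqrt] at hwin
    have hu : 0 ≤ 3 * c / (4 * ν) * (∫ x, ‖curl v x‖ ^ 2) ^ (3 / 4 : ℝ) := by positivity
    have hwin' : |(∫ x, frobeniusNormSq (fderiv ℝ (curl v) x)) ^ (1 / 4 : ℝ) -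
        3 * c / (4 * ν) * (∫ x, ‖curl v x‖ ^ 2) ^ (3 / 4 : ℝ)| ≤
        δ' * (3 * c / (4 * ν) * (∫ x, ‖curl v x‖ ^ 2) ^ (3 / 4 : ℝ)) :=
      hwin.trans (mul_le_mul_of_nonneg_right (by linarith) hu)
    exact hmain ν hν v hv hZ heff' hwin'

end NearSaturationNearMaximiser

end Summit.NavierStokesRegularity.NavierStokesRegularity.Theorems

end
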